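import Literature.MathematicalPhysics.QuantumFieldTheory.Balaban1983to89.B11Ineq88KernelColumnsTwoBackgroundLatticeFree
import Literature.MathematicalPhysics.QuantumFieldTheory.Balaban1983to89.B11Ineq98W80LettersFlatChain
import Literature.MathematicalPhysics.QuantumFieldTheory.Balaban1983to89.B11Eq98W80TwoBackgroundLetters
import Literature.MathematicalPhysics.QuantumFieldTheory.Balaban1983to89.B11Eq117H1kPiLetterDefectAtFlatLatticeFree
import Literature.MathematicalPhysics.QuantumFieldTheory.Balaban1983to89.B11Eq44COperatorTowerTwoBackgrounds
import Literature.MathematicalPhysics.QuantumFieldTheory.Balaban1983to89.B11Eq98V0CurrentBackgroundModulusLatticeUniform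
import Literature.MathematicalPhysics.QuantumFieldTheory.Balaban1983to89.B11Eq120SolutionContinuity
import Literature.MathematicalPhysics.QuantumFieldTheory.Balaban1983to89.B11Eq56CubicRemainderUniform
import Literature.MathematicalPhysics.QuantumFieldTheory.Balaban1983to89.B11Eq96CommutatorCurrent
import Literature.MathematicalPhysics.QuantumFieldTheory.Balaban1983to89.B3Op116ScaleChains
import Literature.MathematicalPhysics.QuantumFieldTheory.Balaban1983to89.B11Eq80CurrentTwoCarriers

/-!
# `Balaban1983to89.B11Ineq98W80TwoBackgroundLatticeFree` — T. Bałaban, *The variational problem and background fields in renormalization group method for lattice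
# gauge theories*, Commun. Math. Phys. **102** (1985) 277–309 [Balaban1985Variational] Prop. 4 (97)–(98) pp. 292–293, (68)–(73) pp. 288–289, (80)–(90) pp. 290–291,
# Prop. 6 (117)–(120) p. 295 («all the functions … depend analytically on U … |(δ/δA′)V(U; A′) − (δ/δA′)V(1; A′)| ≤ O(1)·(j₀ + α)»); [Balaban1985BackgroundPropagators]
# (3.36) p. 396, Thm 3.4 p. 400, (3.122) p. 420, (3.126) p. 420, (3.132)–(3.133) p. 422; [Balaban1985Averaging] Prop. 5 (157) p. 42, Proposition 7 p. 43:
# **THE BACKGROUND MODULUS `δ_W` OF THE GENUINE (L3) SLOT `W80 = (δ/δA′)V` AT PRINT's `k`-TH-STEP OPERATOR IS LATTICE-FREE** — for every lattice of the tower, every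
# background `U` of the cell's MODEL block, on one ball `‖P‖ < R`:
# `‖W80(U; H̃_{1,k}(U), C_k(U), J₁, Δ_π(U))(P) − W80(1; H_{1,k}(1), C_k(1), J₂, Δ_π(1))(ιP)‖₍₋₃₎ ≤ K·(j₀ + α)` with `(α₁, j₁, B, δ)` BEFORE the scalar letters and `K`
# BEFORE the lattice — THE ASSEMBLY of this lineage's bricks: the ι-free junction `B11Eq98W80TwoBackgroundLetters.norm_W80_sub_W80_le_pair` at the pair `(P, ιP)` fed by the
# two-background kernel-column letters `B11Ineq88KernelColumnsTwoBackgroundLatticeFree` (`δθ_E`, `δθ′`; field defect `D := c_T(j₀ + α)`), the one-background letters at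
# `U` and at the chain's vacuum `B11Ineq98W80LettersFlatChain` (`θ₃`, `θ_E`, `N₁`, `hsym`), the composite-current norm defect
# `B11Eq88LaplaceH1CurrentTwoBackgroundOneBlockColumn` (`δ_N`), the Sect. C map across the carriers (`B11Eq120SolutionContinuity.norm_map_sectC_sub_le` with the
# lattice-free letter defect of `H̃_{1,k}` `B11Eq117H1kPiLetterDefectAtFlatLatticeFree` and [4] Prop. 7 as a modulus of `C_k` `B11Eq44COperatorTowerTwoBackgrounds`:
# `δ_T`, `δ_{CT}` by `B11Eq56CubicRemainderUniform.norm_sub_le_of_quad`), the V₀-group's lattice-free modulus `B11Eq98V0CurrentBackgroundModulusLatticeUniform`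
# (`δ_{VT}` by `B11Eq80CurrentTwoCarriers.norm_sub_le_of_quad_entire`) and the (27)-symmetry `B11Eq88LaplaceH1CurrentSymmetry`.  Every letter is linear in `j₀ + α`
# with a coefficient in the displayed scalars (`ϖ, ϖ′, ω, Ω, ω₃, Ω_B, C_V, R_V, M_ρ, M_J, b_H, a_C, ε_C`) — NO operator norm of `Δ_π`, NO bond count, NO `η⁻¹`.
# NE9 crux-team LEAF PROVER 01 (`b2b-balaban-t4-ne9-formalise-leaf-01`), gen 105; cell `pub-balaban`∕`t4`, row NE9, bears_on R4/N22; composition BY NAME; [folklore].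
WHAT IS PROVED (sorry-free; 0 `def`): **`exists_W80_sub_flat_latticeFree`**.  HONEST SCOPE: composition BY NAME on the cell's MODEL rows (O-NE9-1; #5 UNRULED); constants
crude; first order at the flat point; the windows, both Sect. C regimes, the V₀-group's (98)-bounds at `U` and at `1`, the current windows `‖J_i‖ ≤ M_J·j₀`, Prop. 7's
smallness inequalities and the complex Prop. 5 regime stay HYPOTHESES; nothing of [B11] Prop. 4, (68)–(73), (88), Prop. 6 (117)–(120), [B9] (3.36), Thm 3.4, (3.126),
(3.132)–(3.133) or [B7] Prop. 5∕7 asserted as printed; «NE9 ⇐ the named binders»; NE9 NOT PRINTED ∕ NOT PROVED; spine PROVED 0∕9; rung (B)+1 finite T⁴ — NOT infinite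
volume, NOT mass gap, NOT BetaPertH, NOT Clay.  HONEST DEPENDENCY: continuum YM on T⁴ ⇐ BetaPertH ∧ nine spine estimates (0/9 proved); BetaPertH ⇐ (D1) ∧ (D4) ∧
CAP+tail; G-an2-4 gates asym, D1 and NE2/3/4.  NEW file; nothing modified.  Net new unproved facts: 0.
-/

noncomputable section

open scoped InnerProductSpace ComplexConjugate BigOperators

namespace Literature.MathematicalPhysics.QuantumFieldTheory.Balaban1983to89.B11Ineq98W80TwoBackgroundLatticeFree

open B4Sect5Torus (TSite tdist)
open B4Sect5Proof (latticeConst latticeConst_nonneg)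
open B9SectCLatticeCarrier (Bond bpos shift unshift)
open B7Prop1Explicit (U1 Wcx boxVec)
open B11Eq103H1Complex (SiteL2K BondL2K H1LatticeCLM)
open B9Eq310DeltaPrime (plaqHolU)
open B9Eq310HessianOperator (adTransportW hessOp)
open B9Eq315QTorus (perCfg cornerSite)
open B9Eq315QTower (towerP UlevOf)
open B9Eq315QTowerFlat (perCfg_UlevOf_one_mem_U1 norm_Wcx_UlevOf_one_sub_one_le)
open B9Eq326OperatorTower (QkW laplaceAk RofUk)
open B9Eq324DeltaPrimeATower (laplacePrimeAk)
open B9Eq3119DeltaPiTower (laplaceAkPi)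
open B9Eq3119DeltaPiCarrier (currentCLM)
open B11Eq115Space
open B11Eq111FrakG (nabla115 jetLinearEquiv)
open B11Eq174Chart (Regime solA)
open B11Eq90V0GroupComposed (T47 norm_T47_lt)
open B11Eq80Current (W80)
open B11Eq80CurrentTwoCarriers (flat115_jetId norm_sub_le_of_quad_entire)
open B11Eq63V0GroupCurrent (curV0)
open B11Eq90V0primeCurrent (differentiable_curV0prime)
open B11Eq96CommutatorCurrent (differentiable_curComm)
open B11Eq44COperatorTower (C2T C2T_nonneg)
open B11Eq44CLetterTower (Cck prop4Hyp_Cck)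
open B11Eq44COperatorTowerTwoBackgrounds (sectC_modulus_tower)
open B11Eq56CubicRemainderUniform (norm_sub_le_of_quad)
open B11Eq120SolutionContinuity (norm_map_sectC_sub_le)
open B7Eq43AveragedSmallnessLevelFree (pdev_perCfg_le_of_plaq)
open B7Prop2Explicit (pdev AvgClosed C0 c2')
open B7Prop3Flat (c3)
open B7Prop5GeneralLevels (thetaGen C3Gen)
open B7Prop5CplxLevels (epsCplx tauCplx C3Cplx)
open B3Op116ScaleChains (latticeConst_antitone)
open B11Eq98W80TwoBackgroundLetters (norm_W80_sub_W80_le_pair)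
open B11Ineq88KernelColumnsTwoBackgroundLatticeFree (exists_kernelColumns_sub_flat_latticeFree)
open B11Ineq98W80LettersFlatChain (pairSum_current_flat_chain_comm exists_W80letters_flat_chain)
open B11Eq88LaplaceH1CurrentTwoBackgroundOneBlockColumn (exists_norm_current_laplaceH1_sub_flat_le)
open B11Eq117H1kPiLetterDefectAtFlatLatticeFree (exists_H1kPi_letterDefect_at_flat_latticeFree)
open B11Eq98V0CurrentBackgroundModulusLatticeUniform (curV0_background_modulus_flat_latticeUniform)
open B11Eq88LaplaceH1CurrentSymmetry (pairSum_current_laplaceAkPi_sub_QaQ_comm)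

variable {d : ℕ} (hd : 1 ≤ d) (L : ℕ) [NeZero L] (hL : 1 ≤ L) (hL2 : 2 ≤ L) (hL3 : 3 ≤ L) [Fact (0 < (L : ℝ))]
  {𝔸 : Type*} [NormedRing 𝔸] [NormedAlgebra ℂ 𝔸] [CompleteSpace 𝔸] [NormOneClass 𝔸] [StarRing 𝔸] [NormedStarGroup 𝔸] [StarModule ℂ 𝔸] [FiniteDimensional ℂ 𝔸]
  {W : Type*} [NormedAddCommGroup W] [InnerProductSpace ℂ W] [FiniteDimensional ℂ W] (φ : W ≃ₗ[ℂ] 𝔸)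
  {Mφ Mφ' : ℝ} (hMφ : 0 ≤ Mφ) (hMφ' : 0 ≤ Mφ') (hφ : ∀ w, ‖φ w‖ ≤ Mφ * ‖w‖) (hφ' : ∀ X, ‖φ.symm X‖ ≤ Mφ' * ‖X‖) (hstar : ∀ X : 𝔸, ‖star X‖ ≤ ‖X‖)
  {a : ℝ} (ha : 0 < a) {a' : ℝ} (ha' : 0 < a') {ϱ : ℝ} (hϱ0 : 0 ≤ ϱ) (hϱ1 : ϱ < 1)
  (τ : 𝔸 →ₗ[ℂ] ℂ) {Cτ : ℝ} (hτ : ∀ X, ‖τ X‖ ≤ Cτ * ‖X‖) (hCτ : 0 ≤ Cτ) {Mτ : ℝ} (hτm : ∀ X Y : 𝔸, ‖τ (X * Y)‖ ≤ Mτ * ‖X‖ * ‖Y‖) (hMτ : 0 ≤ Mτ)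
  {ρw : ℝ} (hρw : 0 ≤ ρw)
  (hτ₁ : ∀ X : 𝔸, τ (star X) = conj (τ X)) (hτ₂ : ∀ X Y : 𝔸, τ (X * Y) = τ (Y * X)) (hφτ : ∀ X Y : 𝔸, ⟪φ.symm X, φ.symm Y⟫_ℂ = τ (star X * Y))
  (AQ : ℝ)
  {ι : Type} [Fintype ι] [DecidableEq ι] (b : Module.Basis ι ℝ 𝔸) {M₂ : ℝ} (hM₂ : 0 ≤ M₂) (hrepr : ∀ (v : 𝔸) (i : ι), |b.repr v i| ≤ M₂ * ‖v‖)
  -- the `C_k` data BEFORE the lattice: [4] Prop. 2's subgroup and `α₀`, the (115)-ball radius `ρ` of `C_k` (also Prop. 5's field size), Prop. 7's polydisc radius `r′` (coarse units)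
  {Gr : Subgroup 𝔸ˣ} (hGr : AvgClosed d L Gr) {α₀ : ℝ} (hα₀ : 0 < α₀) (hα3 : C0 d * α₀ ≤ 1 / 3) (hα8 : 8 * α₀ ≤ c2' d L)
  {ρ : ℝ} (hρ0 : 0 < ρ) (hρ : Real.exp (4 * (800 * ((d : ℝ) + 1) ^ 2 * ((d : ℝ) + 4)) * α₀) * (1 + 8 * (131072 * ((d : ℝ) + 1) ^ 2) * ρ) ≤ 2)
  (hρ4 : 4 * ρ ≤ c3 d L) (hθ : 2 * d * thetaGen d L α₀ ≤ (L : ℝ) ^ 3 / 16) (hC3 : 2 * d * C3Gen d L * ρ ≤ 1)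
  {r' : ℝ} (hr' : 0 < r')
  (h7s' : Real.exp (4 * (800 * ((d : ℝ) + 1) ^ 2 * ((d : ℝ) + 4)) * α₀) * (1 + 8 * (131072 * ((d : ℝ) + 1) ^ 2) * r') ≤ 2)
  (h7c' : 2 * r' ≤ c3 d L) (h7r'1 : 409600 * ((d : ℝ) + 1) ^ 2 * r' ≤ 1)
  (h7s : Real.exp (4480 * ((d : ℝ) + 1) ^ 2 * ((d : ℝ) + 4) * α₀ + 240000 * ((d : ℝ) + 1) ^ 3 * r') * (1 + 8 * (2097152 * ((d : ℝ) + 1) ^ 2) * ρ) ≤ 2)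
  (h7c : 16 * ρ < c3 d L) (h7β : (d : ℝ) * C3Cplx d L * ρ ≤ 1)

-- deep definitional unfolding `laplaceAkPi` ↦ `laplaceALatticeK … (π†Δπ) …` in the statement (as the hosts)
  -- the displayed scalar letters of the W-slot and of the profiles (consumer constants, BEFORE everything)
  {ϖ ϖ' ω Ω ω₃ ΩB CV RV Mρ MJ bH : ℝ} (hϖ0 : 0 ≤ ϖ) (hϖ'0 : 0 ≤ ϖ') (hω1 : 1 ≤ ω) (hΩ1 : 1 ≤ Ω) (hω₃0 : 0 ≤ ω₃) (hΩB0 : 0 ≤ ΩB)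
  (hCV : 0 ≤ CV) (hRV : 0 < RV) (hRV' : RV ≤ 1 / 16) (hMρ : 0 ≤ Mρ) (hMJ : 0 ≤ MJ) (hbH : 0 ≤ bH)

-- deep definitional unfolding `laplaceAkPi` ↦ `laplaceALatticeK … (π†Δπ) …` in the statement (as the hosts)
set_option maxRecDepth 8192 in
set_option maxHeartbeats 12800000 in
include hd hL hL2 hL3 hMφ hMφ' hφ hφ' hstar ha ha' hϱ0 hϱ1 hτ hCτ hτm hMτ hρw hτ₁ hτ₂ hφτ hM₂ hrepr hGr hα₀ hα3 hα8 hρ0 hρ hρ4 hθ hC3 hr' h7s' h7c' h7r'1 h7s h7c h7β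
  hϖ0 hϖ'0 hω1 hΩ1 hω₃0 hΩB0 hCV hRV hRV' hMρ hMJ hbH in
/-- **THE BACKGROUND MODULUS OF THE GENUINE (L3) SLOT IS LATTICE-FREE** — see the module docstring: `∃ (α₁, j₁, B, δ)`, then for all scalar letters `(a_C, ε_C, R)` with
`2R ≤ a_C`, `6(ε_C + a_C) ≤ ρ`, `4(ε_C + a_C) < R_V`, the contraction `4b_HC₂·3(ε_C + a_C) < 1` and the kernel-route window `(ε_C + a_C)ΘΓ ≤ ½`, `∃ K ≥ 0` such that for
every lattice of the tower, every background of the MODEL block, the `C_k` data, the two Sect. C regimes, the profile bounds, the W-slot letters and every `‖P‖ < R`: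
`‖W80(U)(P) − W80(1)(ιP)‖ ≤ K·(j₀ + α)`.
[cite: Balaban1985Variational, Prop. 4 (97)–(98) pp.292–293, (68)–(73) pp.288–289, (86)–(90) p.291, Prop. 6 (117)–(120) p.295; Balaban1985BackgroundPropagators, (3.36) p.396, Thm 3.4 p.400, (3.126) p.420, (3.132)–(3.133) p.422; Balaban1985Averaging, Prop. 5 (157) p.42, Proposition 7 p.43] -/
theorem exists_W80_sub_flat_latticeFree :
    ∃ α₁ j₁ B δ : ℝ, 0 < α₁ ∧ 0 < j₁ ∧ 0 ≤ B ∧ 0 < δ ∧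
      ∀ (aC εC R : ℝ) (_haC : 0 < aC) (_hεC : 0 ≤ εC) (_hR0 : 0 < R) (_hR : 2 * R ≤ aC) (_hεa : 6 * (εC + aC) ≤ ρ) (_hεV : 4 * (εC + aC) < RV)
        (_hcontr : 4 * bH * C2T d α₀ * (2 * (εC + aC) + (εC + aC)) < 1)
        (_hq : (εC + aC) * (Mφ * B * Mφ' * (d * latticeConst d δ)) * (C3Gen d L * (2 ^ d * (2 * d))) ≤ 1 / 2),
      ∃ K : ℝ, 0 ≤ K ∧
      ∀ (n : ℕ) (η : ℝ) [Fact (0 < η)] (_hηL : η * (L : ℝ) ^ (n + 1) = 1) (c₀ c₁ : ℝ) [Fact (0 < c₀)] [Fact (0 < c₁)]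
        (_hw : c₀ * ((L : ℝ) ^ (n + 1)) ^ d = c₁) (_hρ : |η| ^ d / c₀ ≤ ρw) (m : Fin d → ℕ) [∀ i, NeZero (m i)] (_hm : ∀ i, 1 ≤ m i)
        (U : Bond d (towerP L m (n + 1)) → 𝔸ˣ) (αU : ℕ → ℝ) (_hα0 : ∀ j, 0 ≤ αU j) (hα1 : ∀ j, αU j ≤ 1 / 64)
        (_hαL : ∀ j, 50 * (d + 1) * αU j * (L : ℝ) ^ d ≤ 1 / 2)
        (hU1 : ∀ (j : ℕ) (x : B7Prop1Explicit.Site d) (k : Fin d), perCfg (towerP L m (j + 1)) (UlevOf L m (n + 1) U j) x k ∈ U1 𝔸)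
        (hreg : ∀ (j : ℕ) (y : TSite d (towerP L m j)) (k : Fin d) (ρ' : Fin d → Fin L),
          ‖((Wcx L (perCfg (towerP L m (j + 1)) (UlevOf L m (n + 1) U j)) (cornerSite L y) k (boxVec L ρ') : 𝔸ˣ) : 𝔸) - 1‖ ≤ αU j)
        (εU : ℕ → ℝ) (_hεU : ∀ j, 0 ≤ εU j) (_hε1 : ∀ j, εU j ≤ 1) (_hUε : ∀ (j : ℕ) (b : Bond d (towerP L m (j + 1))), ‖(UlevOf L m (n + 1) U j b : 𝔸) - 1‖ ≤ εU j)
        (_hLb : ∀ (j : ℕ) (b : Bond d (towerP L m (j + 1))), UlevOf L m (n + 1) U j b ∈ U1 𝔸)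
        (α : ℝ) (_hα : 0 ≤ α) (_hαle : α ≤ α₁)
        (hUst : ∀ b, star (U b : 𝔸) = (((U b)⁻¹ : 𝔸ˣ) : 𝔸)) (_hUb : ∀ b, U b ∈ U1 𝔸) (_hUη : ∀ b, ‖(U b : 𝔸) - 1‖ ≤ α * η)
        (_hUw : ∀ (x : TSite d (towerP L m (n + 1))) (μ ν : Fin d), ‖(U (shift ν x, μ) : 𝔸) - (U (x, μ) : 𝔸)‖ ≤ α * η ^ 2)
        (_hpl : ∀ p : B9SectCLatticeCarrier.Plaq d (towerP L m (n + 1)), ‖(plaqHolU U p : 𝔸) - 1‖ ≤ α * η ^ 2)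
        (_hUgrad : ∀ (x : TSite d (towerP L m (n + 1))) (μ : Fin d), ‖(U (x, μ) : 𝔸) - U (unshift μ x, μ)‖ ≤ α * η ^ 2)
        (_hRlev : ∀ (j : ℕ) (b : Bond d (towerP L m (j + 1))) (w : W), ‖adTransportW φ (UlevOf L m (n + 1) U j) b w‖ ≤ ‖w‖)
        (_hεg : ∀ j < n + 1, εU j ≤ α * ϱ ^ j) (_hAQ : ∑ j ∈ Finset.range (n + 1), αU j ≤ AQ)
        (hpos' : ∀ x : SiteL2K ℂ d (towerP L m (n + 1)) c₀ W, x ≠ 0 → 0 < RCLike.re ⟪x, laplacePrimeAk L m n φ η U a' (c₁ := c₁) x⟫_ℂ)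
        (hpos : ∀ x : BondL2K ℂ d (towerP L m (n + 1)) c₀ W, x ≠ 0 →
          0 < RCLike.re ⟪x, laplaceAk L m n φ η U hL αU hα1 hU1 hreg τ (c₀ := c₀) (c₁ := c₁) a x⟫_ℂ)
        (_hc₀η : c₀ = η ^ d) (j₀ : ℝ) (_hJ : ∀ μ y, ‖B9Eq39Adjoint.J (fun μ => B9Eq33CovDerivVector.shiftEquiv μ) (fun μ y => U (y, μ)) η μ y‖ ≤ j₀) (_hj : j₀ ≤ j₁)
        (hposπ : ∀ x : BondL2K ℂ d (towerP L m (n + 1)) c₀ W, x ≠ 0 →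
          0 < RCLike.re ⟪x, laplaceAkPi L m n φ τ η U a' hpos' hL αU hα1 hU1 hreg (c₁ := c₁) a x⟫_ℂ)
        (hQ : Function.Surjective (QkW L m n φ U hL αU hα1 hU1 hreg (c₀ := c₀) (c₁ := c₁)))
        (hpos'₁ : ∀ x : SiteL2K ℂ d (towerP L m (n + 1)) c₀ W, x ≠ 0 →
          0 < RCLike.re ⟪x, laplacePrimeAk L m n φ η (fun _ : Bond d (towerP L m (n + 1)) => (1 : 𝔸ˣ)) a' (c₁ := c₁) x⟫_ℂ)
        (hpos₁ : ∀ x : BondL2K ℂ d (towerP L m (n + 1)) c₀ W, x ≠ 0 →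
          0 < RCLike.re ⟪x, laplaceAk L m n φ η (fun _ : Bond d (towerP L m (n + 1)) => (1 : 𝔸ˣ)) hL (fun _ => 0) (fun _ => by norm_num)
            (perCfg_UlevOf_one_mem_U1 L m (n + 1)) (norm_Wcx_UlevOf_one_sub_one_le L m (n + 1) (fun _ => 0) (fun _ => le_rfl)) τ
            (c₀ := c₀) (c₁ := c₁) a x⟫_ℂ)
        (hQ1 : Function.Surjective (QkW L m n φ (fun _ : Bond d (towerP L m (n + 1)) => (1 : 𝔸ˣ)) hL (fun _ => 0) (fun _ => by norm_num)
          (perCfg_UlevOf_one_mem_U1 L m (n + 1)) (norm_Wcx_UlevOf_one_sub_one_le L m (n + 1) (fun _ => 0) (fun _ => le_rfl)) (c₀ := c₀) (c₁ := c₁)))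
        (lev₀ : Bond d (towerP L m (n + 1)) → ℕ) (levB : Bond d m → ℕ) (lev₁ : Bond d (towerP L m (n + 1)) × Fin d → ℕ) (_hlev : ∀ b, n + 1 ≤ lev₀ b)
        (_hUG : ∀ (x : B7Prop1Explicit.Site d) (κ : Fin d), perCfg (towerP L m (n + 1)) U x κ ∈ Gr)
        (_h52 : pdev (perCfg (towerP L m (n + 1)) U) < α₀ * (((L : ℝ) ^ (n + 1))⁻¹) ^ 2)
        (_h7E : epsCplx d L (r' / (L : ℝ) ^ (n + 1)) (n + 1) ≤ 1 / 16)
        (_h7dX : (d : ℝ) * (epsCplx d L (r' / (L : ℝ) ^ (n + 1)) (n + 1) + tauCplx d L α₀ (n + 1) (r' / (L : ℝ) ^ (n + 1)) (n + 1)) ≤ 1 / 16)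
        (_RC : Regime (H1LatticeCLM (L := (L : ℝ)) (η := η) (lev₀ := lev₀) (levB := levB) φ hposπ hQ lev₁ (nabla115 η U)) 0
          (Cck L m η (n + 1) U lev₀ lev₁ (nabla115 η U) levB) bH 0 (C2T d α₀) ρ 0 aC εC)
        (_RC₁ : Regime (H1LatticeCLM (L := (L : ℝ)) (η := η) (lev₀ := lev₀) (levB := levB) (c := ((η : ℂ))⁻¹)
              (R := adTransportW φ (fun _ : Bond d (towerP L m (n + 1)) => (1 : 𝔸ˣ)))
              (S := adTransportW φ fun _ : Bond d (towerP L m (n + 1)) => (1 : 𝔸ˣ)⁻¹) (Δ₁ := hessOp φ η (fun _ : Bond d (towerP L m (n + 1)) => (1 : 𝔸ˣ)) τ)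
              (Rr := RofUk L m n φ η (fun _ : Bond d (towerP L m (n + 1)) => (1 : 𝔸ˣ)))
              (Q := (QkW L m n φ (fun _ : Bond d (towerP L m (n + 1)) => (1 : 𝔸ˣ)) hL (fun _ => 0) (fun _ => by norm_num)
                (perCfg_UlevOf_one_mem_U1 L m (n + 1)) (norm_Wcx_UlevOf_one_sub_one_le L m (n + 1) (fun _ => 0) (fun _ => le_rfl)) (c₀ := c₀) (c₁ := c₁))) (a := a)
              φ hpos₁ hQ1 lev₁ (nabla115 η (fun _ : Bond d (towerP L m (n + 1)) => (1 : 𝔸ˣ)))) 0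
          (Cck L m η (n + 1) (fun _ : Bond d (towerP L m (n + 1)) => (1 : 𝔸ˣ)) lev₀ lev₁ (nabla115 η (fun _ : Bond d (towerP L m (n + 1)) => (1 : 𝔸ˣ))) levB) bH 0 (C2T d α₀) ρ 0 aC εC)
        (_hϖ : ∀ bb b' : Bond d (towerP L m (n + 1)), levWeight (L : ℝ) η lev₀ 3 bb / levWeight (L : ℝ) η lev₀ 3 b' ≤ ϖ)
        (_hϖ' : ∀ bb b' : Bond d (towerP L m (n + 1)), levWeight (L : ℝ) η lev₀ 3 bb / levWeight (L : ℝ) η lev₀ 1 b' ≤ ϖ')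
        (_hw₀ : (NegSup.wSup (levWeight (L : ℝ) η lev₀ 1) : ℝ) ≤ ω) (_hw₁ : (NegSup.wSup (levWeight (L : ℝ) η lev₁ 2) : ℝ) ≤ ω)
        (_hw₁' : (NegSup.wInvSup (levWeight (L : ℝ) η lev₀ 1) : ℝ) ≤ Ω) (_hw₁₂ : (NegSup.wInvSup (levWeight (L : ℝ) η lev₁ 2) : ℝ) ≤ Ω)
        (_hw₃ : (NegSup.wSup (levWeight (L : ℝ) η lev₀ 3) : ℝ) ≤ ω₃) (_hwB : (NegSup.wInvSup (levWeight (L : ℝ) η levB 0) : ℝ) ≤ ΩB)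
        (_hUlev : ∀ (j : ℕ) (bb : Bond d (towerP L m (j + 1))), star (UlevOf L m (n + 1) U j bb : 𝔸) = ((UlevOf L m (n + 1) U j bb)⁻¹ : 𝔸ˣ))
        (ρV : (𝔸 →L[ℂ] ℂ) →L[ℂ] 𝔸) (_hρn : ‖ρV‖ ≤ Mρ) (J₁ J₂ : NegSize (L : ℝ) η lev₀ 3 𝔸) (_hJ₁ : ‖J₁‖ ≤ MJ * j₀) (_hJ₂ : ‖J₂‖ ≤ MJ * j₀)
        (_hqV : ∀ Y : Space115 (L : ℝ) η lev₀ lev₁ (nabla115 η U), ‖Y‖ < RV →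
          ‖curV0 (lev₁ := lev₁) (Dc := nabla115 η U) ρV (LinearMap.toContinuousLinearMap τ) U Y‖ ≤ CV * ‖Y‖ ^ 2)
        (_hqV₁ : ∀ Y : Space115 (L : ℝ) η lev₀ lev₁ (nabla115 η (fun _ : Bond d (towerP L m (n + 1)) => (1 : 𝔸ˣ))), ‖Y‖ < RV →
          ‖curV0 (lev₁ := lev₁) (Dc := nabla115 η (fun _ : Bond d (towerP L m (n + 1)) => (1 : 𝔸ˣ))) ρV (LinearMap.toContinuousLinearMap τ) (fun _ : Bond d (towerP L m (n + 1)) => (1 : 𝔸ˣ)) Y‖ ≤ CV * ‖Y‖ ^ 2)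
        (P : Space115 (L : ℝ) η lev₀ lev₁ (nabla115 η U)) (_hP : ‖P‖ < R),
        ‖W80 ρV (LinearMap.toContinuousLinearMap τ) U (H1LatticeCLM (L := (L : ℝ)) (η := η) (lev₀ := lev₀) (levB := levB) φ hposπ hQ lev₁ (nabla115 η U))
              (Cck L m η (n + 1) U lev₀ lev₁ (nabla115 η U) levB) εC J₁
              (currentCLM φ lev₁ (nabla115 η U)
                (laplaceAkPi L m n φ τ η U a' hpos' hL αU hα1 hU1 hreg (c₁ := c₁) a
                  - LinearMap.adjoint (QkW L m n φ U hL αU hα1 hU1 hreg (c₀ := c₀) (c₁ := c₁)) ∘ₗ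
                      ((a : ℂ) • QkW L m n φ U hL αU hα1 hU1 hreg (c₀ := c₀) (c₁ := c₁)))) P -
            W80 ρV (LinearMap.toContinuousLinearMap τ) (fun _ : Bond d (towerP L m (n + 1)) => (1 : 𝔸ˣ))
              (H1LatticeCLM (L := (L : ℝ)) (η := η) (lev₀ := lev₀) (levB := levB) (c := ((η : ℂ))⁻¹)
              (R := adTransportW φ (fun _ : Bond d (towerP L m (n + 1)) => (1 : 𝔸ˣ)))
              (S := adTransportW φ fun _ : Bond d (towerP L m (n + 1)) => (1 : 𝔸ˣ)⁻¹) (Δ₁ := hessOp φ η (fun _ : Bond d (towerP L m (n + 1)) => (1 : 𝔸ˣ)) τ)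
              (Rr := RofUk L m n φ η (fun _ : Bond d (towerP L m (n + 1)) => (1 : 𝔸ˣ)))
              (Q := (QkW L m n φ (fun _ : Bond d (towerP L m (n + 1)) => (1 : 𝔸ˣ)) hL (fun _ => 0) (fun _ => by norm_num)
                (perCfg_UlevOf_one_mem_U1 L m (n + 1)) (norm_Wcx_UlevOf_one_sub_one_le L m (n + 1) (fun _ => 0) (fun _ => le_rfl)) (c₀ := c₀) (c₁ := c₁))) (a := a)
              φ hpos₁ hQ1 lev₁ (nabla115 η (fun _ : Bond d (towerP L m (n + 1)) => (1 : 𝔸ˣ))))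
              (Cck L m η (n + 1) (fun _ : Bond d (towerP L m (n + 1)) => (1 : 𝔸ˣ)) lev₀ lev₁ (nabla115 η (fun _ : Bond d (towerP L m (n + 1)) => (1 : 𝔸ˣ))) levB) εC J₂
              (currentCLM φ lev₁ (nabla115 η (fun _ : Bond d (towerP L m (n + 1)) => (1 : 𝔸ˣ)))
                (laplaceAk L m n φ η (fun _ : Bond d (towerP L m (n + 1)) => (1 : 𝔸ˣ)) hL (fun _ => 0) (fun _ => by norm_num)
                    (perCfg_UlevOf_one_mem_U1 L m (n + 1)) (norm_Wcx_UlevOf_one_sub_one_le L m (n + 1) (fun _ => 0) (fun _ => le_rfl)) τ (c₀ := c₀) (c₁ := c₁) a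
                  - LinearMap.adjoint (QkW L m n φ (fun _ : Bond d (towerP L m (n + 1)) => (1 : 𝔸ˣ)) hL (fun _ => 0) (fun _ => by norm_num)
                      (perCfg_UlevOf_one_mem_U1 L m (n + 1)) (norm_Wcx_UlevOf_one_sub_one_le L m (n + 1) (fun _ => 0) (fun _ => le_rfl)) (c₀ := c₀) (c₁ := c₁)) ∘ₗ
                      ((a : ℂ) • (QkW L m n φ (fun _ : Bond d (towerP L m (n + 1)) => (1 : 𝔸ˣ)) hL (fun _ => 0) (fun _ => by norm_num)
                        (perCfg_UlevOf_one_mem_U1 L m (n + 1)) (norm_Wcx_UlevOf_one_sub_one_le L m (n + 1) (fun _ => 0) (fun _ => le_rfl)) (c₀ := c₀) (c₁ := c₁)))))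
              ((LinearMap.toContinuousLinearMap
              ((jetLinearEquiv (L : ℝ) η lev₀ lev₁ (nabla115 η (fun _ : Bond d (towerP L m (n + 1)) => (1 : 𝔸ˣ)))).symm.toLinearMap ∘ₗ
                (jetLinearEquiv (L : ℝ) η lev₀ lev₁ (nabla115 η U)).toLinearMap)) P)‖ ≤ K * (j₀ + α) := by
  classical
  obtain ⟨αA, jA, BA, δA, KA, κA, hαA, hjA, hBA, hδA, hKA, hκA, HA⟩ :=
    exists_kernelColumns_sub_flat_latticeFree hd L hL hL2 hL3 φ hMφ hMφ' hφ hφ' hstar ha ha' hϱ0 hϱ1 τ hτ hCτ hτm hMτ hρw hτ₁ hτ₂ hφτ AQ b hM₂ hrepr hGr hα₀ hα3 hα8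
      hρ0 hρ hρ4 hθ hC3 hr' h7s' h7c' h7r'1 h7s h7c h7β
  have hα4 : 4 * α₀ ≤ c2' d L := by linarith only [hα8, hα₀]
  obtain ⟨αB, jB, BE, δE, BN, δN, hαB, hjB, hBE, hδE, hBN, hδN, HBU, HBV⟩ :=
    exists_W80letters_flat_chain hd L hL hL2 hL3 φ hMφ hMφ' hφ hφ' hstar ha ha' hϱ0 hϱ1 τ hτ hCτ hτm hMτ hρw hτ₁ hτ₂ hφτ AQ hGr hα₀ hα3 hα4 hρ hρ4 hθ hC3
  obtain ⟨α5, j5, K5, κ5, hα5, hj5, hK5, hκ5, H5⟩ :=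
    exists_norm_current_laplaceH1_sub_flat_le hd L hL hL3 φ hMφ hMφ' hφ hφ' hstar ha ha' hϱ0 hϱ1 τ hτ hCτ hτm hMτ hρw hτ₁ hτ₂ hφτ AQ b hM₂ hrepr
  obtain ⟨αH, jH, KH, hαH, hjH, hKH, H101⟩ :=
    exists_H1kPi_letterDefect_at_flat_latticeFree hd L hL hL3 φ hMφ hMφ' hφ hφ' hstar ha ha' hϱ0 hϱ1 τ hτ hCτ hτm hMτ hρw hτ₁ hτ₂ hφτ AQ b hM₂ hrepr
  have hω0 : 0 ≤ ω := zero_le_one.trans hω1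
  have hΩ0 : 0 ≤ Ω := zero_le_one.trans hΩ1
  refine ⟨min (min (min αA αB) (min α5 αH)) (min (r' / 6) (1 / (2 * ω * Ω + 1))), min (min jA jB) (min j5 jH), max BA BE, min δA δE,
    lt_min (lt_min (lt_min hαA hαB) (lt_min hα5 hαH)) (lt_min (by positivity) (by positivity)), lt_min (lt_min hjA hjB) (lt_min hj5 hjH),
    hBA.trans (le_max_left _ _), lt_min hδA hδE, ?_⟩
  intro aC εC R haC hεC hR0 hR hεa hεV hcontr hq
  have hδm : 0 < min δA δE := lt_min hδA hδE
  have hs0 : 0 < εC + aC := by linarith only [haC, hεC]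
  have hC2T := C2T_nonneg d α₀
  have hC30 : 0 ≤ C3Gen d L := by unfold C3Gen B7Prop5GeneralLevels.C1ppGen; positivity
  have hC3c0 : 0 ≤ C3Cplx d L := by unfold C3Cplx B7Prop5CplxLevels.C1ppCplx; positivity
  have hKdA : 0 ≤ latticeConst d δA := latticeConst_nonneg d hδA.le
  have hKdE : 0 ≤ latticeConst d δE := latticeConst_nonneg d hδE.le
  have hKκA : 0 ≤ latticeConst d κA := latticeConst_nonneg d hκA.le
  have hKκ5 : 0 ≤ latticeConst d κ5 := latticeConst_nonneg d hκ5.le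
  have hKδN : 0 ≤ latticeConst d δN := latticeConst_nonneg d hδN.le
  have h1q : 0 < 1 - 4 * bH * C2T d α₀ * (εC + aC) := by linarith only [hcontr, mul_nonneg (mul_nonneg hbH hC2T) hs0.le]
  have hκC : 0 < 1 - 4 * bH * C2T d α₀ * (2 * (εC + aC) + (εC + aC)) := by linarith only [hcontr]
  -- the window at `(max B_A B_E, min δ_A δ_E)` gives both suppliers' windows
  have hmono : ∀ {B₀ δ₀ : ℝ}, B₀ ≤ max BA BE → min δA δE ≤ δ₀ →
      (εC + aC) * (Mφ * B₀ * Mφ' * (d * latticeConst d δ₀)) * (C3Gen d L * (2 ^ d * (2 * d))) ≤ 1 / 2 := by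
    intro B₀ δ₀ hB₀ hδ₀
    refine le_trans ?_ hq
    have h1 : latticeConst d δ₀ ≤ latticeConst d (min δA δE) := latticeConst_antitone hδm hδ₀
    have hmax0 : 0 ≤ max BA BE := hBA.trans (le_max_left BA BE)
    have h2 : Mφ * B₀ * Mφ' * (d * latticeConst d δ₀) ≤ Mφ * max BA BE * Mφ' * (d * latticeConst d (min δA δE)) :=
      mul_le_mul (mul_le_mul_of_nonneg_right (mul_le_mul_of_nonneg_left hB₀ hMφ) hMφ') (mul_le_mul_of_nonneg_left h1 (Nat.cast_nonneg d))
        (mul_nonneg (Nat.cast_nonneg d) (latticeConst_nonneg d (hδm.le.trans hδ₀))) (by positivity)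
    exact mul_le_mul_of_nonneg_right (mul_le_mul_of_nonneg_left h2 hs0.le) (by positivity)
  have hqA := hmono (le_max_left _ _) (min_le_left _ _)
  have hqE := hmono (le_max_right _ _) (min_le_right _ _)
  -- the constants (every two-background letter is `≤ c·(j₀ + α)`)
  obtain ⟨θE, hθE⟩ : ∃ c : ℝ, c = 2 * (ϖ * (Mφ * BE * Mφ' * (d * latticeConst d δE))) * (C3Gen d L * (2 ^ d * (2 * d))) * (1 / (1 - 4 * bH * C2T d α₀ * (εC + aC))) := ⟨_, rfl⟩
  obtain ⟨θ₃, hθ₃⟩ : ∃ c : ℝ, c = (2 * (1 / (1 - 4 * bH * C2T d α₀ * (εC + aC))) + 1) * (ϖ * (Mφ * BE * Mφ' * (d * latticeConst d δE))) *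
      (C3Gen d L * (2 ^ d * (2 * d))) / aC := ⟨_, rfl⟩
  obtain ⟨Nh, hNh⟩ : ∃ c : ℝ, c = ω₃ * (Mφ * BN * Mφ' * (d * latticeConst d δN)) * ΩB := ⟨_, rfl⟩
  obtain ⟨cN, hcN⟩ : ∃ c : ℝ, c = ω₃ * ((Mφ * K5 * Mφ') * (d * latticeConst d κ5)) * ΩB := ⟨_, rfl⟩
  obtain ⟨cH, hcH⟩ : ∃ c : ℝ, c = ω * (Mφ * KH * Mφ') * ΩB := ⟨_, rfl⟩
  obtain ⟨cC, hcC⟩ : ∃ c : ℝ, c = 24 / r' * (εC + aC) := ⟨_, rfl⟩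
  obtain ⟨cT, hcT⟩ : ∃ c : ℝ, c = (cH * (C2T d α₀ * (εC + aC) ^ 2) + bH * cC) / (1 - 4 * bH * C2T d α₀ * (2 * (εC + aC) + (εC + aC))) := ⟨_, rfl⟩
  obtain ⟨cCT, hcCT⟩ : ∃ c : ℝ, c = cC + 4 * C2T d α₀ * (2 * (εC + aC)) * cT := ⟨_, rfl⟩
  obtain ⟨Γh, hΓh⟩ : ∃ c : ℝ, c = (6 / r' + 24 * cT / ρ) * (C3Cplx d L * ρ) * (2 ^ d * (2 * d)) := ⟨_, rfl⟩
  obtain ⟨Ξh, hΞh⟩ : ∃ c : ℝ, c = 2 * (εC + aC) * ((Mφ * KA * Mφ' * (d * latticeConst d κA)) * (C3Gen d L * (2 ^ d * (2 * d)))) +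
      (2 * ((Mφ * BA * Mφ' * (d * latticeConst d δA)) * Γh) + 4 * (εC + aC) * ((Mφ * BA * Mφ' * (d * latticeConst d δA)) * (C3Gen d L * (2 ^ d * (2 * d)))) *
        ((εC + aC) * ((Mφ * KA * Mφ' * (d * latticeConst d κA)) * (C3Gen d L * (2 ^ d * (2 * d)))) + (Mφ * BA * Mφ' * (d * latticeConst d δA)) * Γh)) := ⟨_, rfl⟩
  obtain ⟨KV, hKV⟩ : ∃ c : ℝ, c = 524288 * Real.exp 4 * ((d - 1 : ℕ) : ℝ) * (ω * Ω) ^ 2 * Mρ * Cτ * RV ^ 2 * ω := ⟨_, rfl⟩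
  obtain ⟨cVT, hcVT⟩ : ∃ c : ℝ, c = KV + 2 * CV * RV * cT := ⟨_, rfl⟩
  have hθE0 : 0 ≤ θE := by rw [hθE]; positivity
  have hθ₃0 : 0 ≤ θ₃ := by rw [hθ₃]; positivity
  have hNh0 : 0 ≤ Nh := by rw [hNh]; positivity
  have hcN0 : 0 ≤ cN := by rw [hcN]; positivity
  have hcH0 : 0 ≤ cH := by rw [hcH]; positivity
  have hcC0 : 0 ≤ cC := by rw [hcC]; positivity
  have hcT0 : 0 ≤ cT := by rw [hcT]; exact div_nonneg (by positivity) hκC.le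
  have hcCT0 : 0 ≤ cCT := by rw [hcCT]; positivity
  have hΓh0 : 0 ≤ Γh := by rw [hΓh]; positivity
  have hΞh0 : 0 ≤ Ξh := by rw [hΞh]; positivity
  have hKV0 : 0 ≤ KV := by rw [hKV]; positivity
  have hcVT0 : 0 ≤ cVT := by rw [hcVT]; positivity
  obtain ⟨K, hK⟩ : ∃ c : ℝ, c = Mρ * Cτ * θ₃ * (MJ * aC ^ 2 + MJ * aC ^ 2) +
      ((cN * (C2T d α₀ * (1 / (1 - 4 * bH * C2T d α₀ * (εC + aC))) ^ 2 * aC ^ 2) + Nh * cCT) + Mρ * Cτ * (ϖ' * Ξh) * aC) +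
      Mρ * Cτ * ((ϖ * Ξh) * (Nh * C2T d α₀ * (1 / (1 - 4 * bH * C2T d α₀ * (εC + aC))) ^ 2 * aC ^ 2) +
        θE * aC * (cN * (C2T d α₀ * (1 / (1 - 4 * bH * C2T d α₀ * (εC + aC))) ^ 2 * aC ^ 2) + Nh * cCT)) +
      Mρ * Cτ * ((ϖ * Ξh) * (CV * (εC + aC) ^ 2) + (1 + θE * aC) * cVT) := ⟨_, rfl⟩
  refine ⟨K, by rw [hK]; positivity, ?_⟩
  intro n η _ hηL c₀ c₁ _ _ hw hρ' m _ hm U αU hα0 hα1 hαL hU1 hreg εU hεU hε1 hUε hLb α hα hαle hUst hUb hUη hUw hpl hUgrad hRlev hεg hAQ hpos' hpos hc₀η j₀ hJ hj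
    hposπ hQ hpos'₁ hpos₁ hQ1 lev₀ levB lev₁ hlev hUG h52 h7E h7dX RC RC₁ hϖ hϖ' hw₀ hw₁ hw₁' hw₁₂ hw₃ hwB hUlev ρV hρn J₁ J₂ hJ₁ hJ₂ hqV hqV₁ P hP
  -- the smallness letters `α ≤ α₁`, `j₀ ≤ j₁` of the five suppliers, `6α ≤ r′`, `α(2ωΩ + 1) ≤ 1`
  obtain ⟨hαle1, hαle2⟩ := And.intro (hαle.trans (min_le_left _ _)) (hαle.trans (min_le_right _ _))
  obtain ⟨hαA', hαB', hα5', hαH'⟩ : α ≤ αA ∧ α ≤ αB ∧ α ≤ α5 ∧ α ≤ αH :=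
    ⟨hαle1.trans ((min_le_left _ _).trans (min_le_left _ _)), hαle1.trans ((min_le_left _ _).trans (min_le_right _ _)),
      hαle1.trans ((min_le_right _ _).trans (min_le_left _ _)), hαle1.trans ((min_le_right _ _).trans (min_le_right _ _))⟩
  obtain ⟨hαr', hαw⟩ : α ≤ r' / 6 ∧ α ≤ 1 / (2 * ω * Ω + 1) := ⟨hαle2.trans (min_le_left _ _), hαle2.trans (min_le_right _ _)⟩
  obtain ⟨hjA', hjB', hj5', hjH'⟩ : j₀ ≤ jA ∧ j₀ ≤ jB ∧ j₀ ≤ j5 ∧ j₀ ≤ jH :=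
    ⟨hj.trans ((min_le_left _ _).trans (min_le_left _ _)), hj.trans ((min_le_left _ _).trans (min_le_right _ _)),
      hj.trans ((min_le_right _ _).trans (min_le_left _ _)), hj.trans ((min_le_right _ _).trans (min_le_right _ _))⟩
  have hη0 : 0 < η := Fact.out
  have hL1r : (1 : ℝ) ≤ (L : ℝ) := by exact_mod_cast hL
  have hK1 : (1 : ℝ) ≤ (L : ℝ) ^ (n + 1) := one_le_pow₀ hL1r
  have hK0' : (0 : ℝ) < (L : ℝ) ^ (n + 1) := lt_of_lt_of_le one_pos hK1
  have hLη : (L : ℝ) ^ (n + 1) * η = 1 := by rw [mul_comm]; exact hηL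
  have hkr' : (L : ℝ) ^ (n + 1) * (r' / (L : ℝ) ^ (n + 1)) = r' := mul_div_cancel₀ _ hK0'.ne'
  have hkρ : (L : ℝ) ^ (n + 1) * (ρ / (L : ℝ) ^ (n + 1)) = ρ := mul_div_cancel₀ _ hK0'.ne'
  have hkε : (L : ℝ) ^ (n + 1) * (α * η) = α := by rw [mul_comm, mul_assoc, hηL, mul_one]
  have hj₀0 : 0 ≤ j₀ := (norm_nonneg _).trans (hJ ⟨0, hd⟩ fun _ => 0)
  have hx : 0 ≤ j₀ + α := add_nonneg hj₀0 hα
  have hαx : α ≤ j₀ + α := by linarith only [hj₀0]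
  have hαx' : j₀ ≤ j₀ + α := by linarith only [hα]
  have hAQ0 : 0 ≤ AQ := (Finset.sum_nonneg fun j _ => hα0 j).trans hAQ
  have hτn : ‖LinearMap.toContinuousLinearMap τ‖ ≤ Cτ :=
    ContinuousLinearMap.opNorm_le_bound _ hCτ fun X => by simpa only [LinearMap.coe_toContinuousLinearMap'] using hτ X
  have hw3n := (NegSup.wSup (levWeight (L : ℝ) η lev₀ 3)).coe_nonneg
  have hwBn := (NegSup.wInvSup (levWeight (L : ℝ) η levB 0)).coe_nonneg
  have hC := prop4Hyp_Cck L m η (n + 1) U lev₀ lev₁ (nabla115 η U) levB hL2 hGr hUG hα₀ hα3 hα4 h52 hlev hρ (by linarith only [hρ4, hρ0])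
  have hUG1 : ∀ (x : B7Prop1Explicit.Site d) (κ : Fin d), perCfg (towerP L m (n + 1)) (fun _ : Bond d (towerP L m (n + 1)) => (1 : 𝔸ˣ)) x κ ∈ Gr :=
    fun x κ => by rw [B9Eq315QTorus.perCfg_apply]; exact Gr.one_mem
  have h52₁ : pdev (perCfg (towerP L m (n + 1)) (fun _ : Bond d (towerP L m (n + 1)) => (1 : 𝔸ˣ))) < α₀ * (((L : ℝ) ^ (n + 1))⁻¹) ^ 2 := by
    have hp := pdev_perCfg_le_of_plaq (U := (fun _ : Bond d (towerP L m (n + 1)) => (1 : 𝔸ˣ))) (fun _ => one_mem _) le_rfl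
      (fun p => by rw [B9Eq310DeltaPrime.plaqHolU_one, Units.val_one, sub_self, norm_zero])
    exact lt_of_le_of_lt hp (by positivity)
  have hC₁ := prop4Hyp_Cck L m η (n + 1) (fun _ : Bond d (towerP L m (n + 1)) => (1 : 𝔸ˣ)) lev₀ lev₁ (nabla115 η (fun _ : Bond d (towerP L m (n + 1)) => (1 : 𝔸ˣ))) levB hL2 hGr hUG1 hα₀ hα3 hα4 h52₁ hlev hρ (by linarith only [hρ4, hρ0])
  -- (1) the jet identity `ι`: `K_ι ≤ 2`; the operator-norm defect `δ_H` of `H̃_{1,k}`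
  obtain ⟨hι, hδH⟩ := H101 n η hηL c₀ c₁ hw hρ' m hm U αU hα0 hα1 hαL hU1 hreg εU hεU hε1 hUε hLb α hα hαH' hUst hUb hUη hUw hpl hUgrad hRlev hεg hAQ hpos' hpos
    hc₀η j₀ hJ hjH' hposπ hQ hpos'₁ hpos₁ hQ1 lev₀ levB lev₁
  have hKι : 1 + (NegSup.wSup (levWeight (L : ℝ) η lev₁ 2) : ℝ) * (2 * α) * NegSup.wInvSup (levWeight (L : ℝ) η lev₀ 1) ≤ 2 := by
    have h1 : (NegSup.wSup (levWeight (L : ℝ) η lev₁ 2) : ℝ) * (2 * α) * NegSup.wInvSup (levWeight (L : ℝ) η lev₀ 1) ≤ ω * (2 * α) * Ω :=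
      mul_le_mul (mul_le_mul_of_nonneg_right hw₁ (by positivity)) hw₁' (NegSup.wInvSup (levWeight (L : ℝ) η lev₀ 1)).coe_nonneg (by positivity)
    have h2 : α * (2 * ω * Ω + 1) ≤ 1 := by rw [← le_div_iff₀ (by positivity)]; exact hαw
    linarith only [h1, h2, hα]
  have hKι0 : 0 ≤ 1 + (NegSup.wSup (levWeight (L : ℝ) η lev₁ 2) : ℝ) * (2 * α) * NegSup.wInvSup (levWeight (L : ℝ) η lev₀ 1) := by positivity
  have hι2 : ∀ f : Space115 (L : ℝ) η lev₀ lev₁ (nabla115 η U), ‖(LinearMap.toContinuousLinearMap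
        ((jetLinearEquiv (L : ℝ) η lev₀ lev₁ (nabla115 η (fun _ : Bond d (towerP L m (n + 1)) => (1 : 𝔸ˣ)))).symm.toLinearMap ∘ₗ
          (jetLinearEquiv (L : ℝ) η lev₀ lev₁ (nabla115 η U)).toLinearMap)) f‖ ≤ 2 * ‖f‖ :=
    fun f => (hι f).trans (mul_le_mul_of_nonneg_right hKι (norm_nonneg f))
  have hPa : ‖P‖ < aC := by linarith only [hP, hR, hR0]
  have hιPa : ‖(LinearMap.toContinuousLinearMap
        ((jetLinearEquiv (L : ℝ) η lev₀ lev₁ (nabla115 η (fun _ : Bond d (towerP L m (n + 1)) => (1 : 𝔸ˣ)))).symm.toLinearMap ∘ₗ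
          (jetLinearEquiv (L : ℝ) η lev₀ lev₁ (nabla115 η U)).toLinearMap)) P‖ < aC := by linarith only [hι2 P, hP, hR]
  have hδH' : ∀ B : NegSize (L : ℝ) η levB 0 𝔸, ‖(LinearMap.toContinuousLinearMap
        ((jetLinearEquiv (L : ℝ) η lev₀ lev₁ (nabla115 η (fun _ : Bond d (towerP L m (n + 1)) => (1 : 𝔸ˣ)))).symm.toLinearMap ∘ₗ
          (jetLinearEquiv (L : ℝ) η lev₀ lev₁ (nabla115 η U)).toLinearMap)) ((H1LatticeCLM (L := (L : ℝ)) (η := η) (lev₀ := lev₀) (levB := levB) φ hposπ hQ lev₁ (nabla115 η U)) B) -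
      (H1LatticeCLM (L := (L : ℝ)) (η := η) (lev₀ := lev₀) (levB := levB) (c := ((η : ℂ))⁻¹)
        (R := adTransportW φ (fun _ : Bond d (towerP L m (n + 1)) => (1 : 𝔸ˣ)))
        (S := adTransportW φ fun _ : Bond d (towerP L m (n + 1)) => (1 : 𝔸ˣ)⁻¹) (Δ₁ := hessOp φ η (fun _ : Bond d (towerP L m (n + 1)) => (1 : 𝔸ˣ)) τ)
        (Rr := RofUk L m n φ η (fun _ : Bond d (towerP L m (n + 1)) => (1 : 𝔸ˣ)))
        (Q := (QkW L m n φ (fun _ : Bond d (towerP L m (n + 1)) => (1 : 𝔸ˣ)) hL (fun _ => 0) (fun _ => by norm_num)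
          (perCfg_UlevOf_one_mem_U1 L m (n + 1)) (norm_Wcx_UlevOf_one_sub_one_le L m (n + 1) (fun _ => 0) (fun _ => le_rfl)) (c₀ := c₀) (c₁ := c₁))) (a := a)
        φ hpos₁ hQ1 lev₁ (nabla115 η (fun _ : Bond d (towerP L m (n + 1)) => (1 : 𝔸ˣ)))) B‖ ≤ (j₀ + α) * cH * ‖B‖ := fun B => by
    refine (hδH B).trans (mul_le_mul_of_nonneg_right ?_ (norm_nonneg B))
    have h0 : 0 ≤ Mφ * ((j₀ + α) * KH) * Mφ' := by positivity
    have hM : max ((NegSup.wSup (levWeight (L : ℝ) η lev₀ 1) : ℝ) * (Mφ * ((j₀ + α) * KH) * Mφ')) (NegSup.wSup (levWeight (L : ℝ) η lev₁ 2) * (Mφ * ((j₀ + α) * KH) * Mφ')) ≤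
        ω * (Mφ * ((j₀ + α) * KH) * Mφ') := max_le (mul_le_mul_of_nonneg_right hw₀ h0) (mul_le_mul_of_nonneg_right hw₁ h0)
    calc _ ≤ ω * (Mφ * ((j₀ + α) * KH) * Mφ') * ΩB := mul_le_mul hM hwB hwBn (mul_nonneg hω0 h0)
      _ = (j₀ + α) * cH := by rw [hcH]; ring
  -- (2) [4] Prop. 7 as a modulus of `C_k`: `δ_C = (24∕r′)·α·(ε_C + a_C) ≤ (j₀ + α)·c_C`
  have hαρ : 6 * (α * η) ≤ r' / (L : ℝ) ^ (n + 1) := by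
    rw [le_div_iff₀ hK0', show 6 * (α * η) * (L : ℝ) ^ (n + 1) = 6 * α * ((L : ℝ) ^ (n + 1) * η) by ring, hLη, mul_one]; linarith only [hαr']
  have hδC := sectC_modulus_tower L m η (n + 1) U hL2 hGr hα₀ hα3 hα8 (ρ' := r' / (L : ℝ) ^ (n + 1)) (ρ := ρ / (L : ℝ) ^ (n + 1)) (by positivity) (by positivity)
    (by rw [hkr']; exact h7s') (by rw [hkr']; exact h7c') (by rw [hkr']; exact h7r'1) (by rw [hkr', hkρ]; exact h7s) (by rw [hkρ]; linarith only [h7c, hρ0])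
    (ε := α * η) (by positivity) hUη hαρ lev₀ levB hlev lev₁ (εC := εC) (aC := aC) (by rw [hkρ]; linarith only [hεa, hs0])
  rw [hkr', hkε] at hδC
  have hδCx : 24 / r' * α * (εC + aC) ≤ (j₀ + α) * cC := by
    rw [hcC, show 24 / r' * α * (εC + aC) = α * (24 / r' * (εC + aC)) by ring]
    exact mul_le_mul_of_nonneg_right hαx (by positivity)
  -- (3) `δ_T`: the Sect. C map (47) across the carriers at `y := ιP`
  have hT : ‖(LinearMap.toContinuousLinearMap
        ((jetLinearEquiv (L : ℝ) η lev₀ lev₁ (nabla115 η (fun _ : Bond d (towerP L m (n + 1)) => (1 : 𝔸ˣ)))).symm.toLinearMap ∘ₗ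
          (jetLinearEquiv (L : ℝ) η lev₀ lev₁ (nabla115 η U)).toLinearMap)) (T47 (H1LatticeCLM (L := (L : ℝ)) (η := η) (lev₀ := lev₀) (levB := levB) φ hposπ hQ lev₁ (nabla115 η U)) (Cck L m η (n + 1) U lev₀ lev₁ (nabla115 η U) levB) εC P) -
      T47 (H1LatticeCLM (L := (L : ℝ)) (η := η) (lev₀ := lev₀) (levB := levB) (c := ((η : ℂ))⁻¹)
        (R := adTransportW φ (fun _ : Bond d (towerP L m (n + 1)) => (1 : 𝔸ˣ)))
        (S := adTransportW φ fun _ : Bond d (towerP L m (n + 1)) => (1 : 𝔸ˣ)⁻¹) (Δ₁ := hessOp φ η (fun _ : Bond d (towerP L m (n + 1)) => (1 : 𝔸ˣ)) τ)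
        (Rr := RofUk L m n φ η (fun _ : Bond d (towerP L m (n + 1)) => (1 : 𝔸ˣ)))
        (Q := (QkW L m n φ (fun _ : Bond d (towerP L m (n + 1)) => (1 : 𝔸ˣ)) hL (fun _ => 0) (fun _ => by norm_num)
          (perCfg_UlevOf_one_mem_U1 L m (n + 1)) (norm_Wcx_UlevOf_one_sub_one_le L m (n + 1) (fun _ => 0) (fun _ => le_rfl)) (c₀ := c₀) (c₁ := c₁))) (a := a)
        φ hpos₁ hQ1 lev₁ (nabla115 η (fun _ : Bond d (towerP L m (n + 1)) => (1 : 𝔸ˣ))))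
        (Cck L m η (n + 1) (fun _ : Bond d (towerP L m (n + 1)) => (1 : 𝔸ˣ)) lev₀ lev₁ (nabla115 η (fun _ : Bond d (towerP L m (n + 1)) => (1 : 𝔸ˣ))) levB) εC ((LinearMap.toContinuousLinearMap
        ((jetLinearEquiv (L : ℝ) η lev₀ lev₁ (nabla115 η (fun _ : Bond d (towerP L m (n + 1)) => (1 : 𝔸ˣ)))).symm.toLinearMap ∘ₗ
          (jetLinearEquiv (L : ℝ) η lev₀ lev₁ (nabla115 η U)).toLinearMap)) P)‖ ≤ (j₀ + α) * cT := by
    have h := norm_map_sectC_sub_le RC RC₁ hPa hιPa hKι0 hι (by positivity) hδH' hδC (ρC := 2 * (εC + aC)) (sC := εC + aC)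
      (mul_le_mul_of_nonneg_right hKι hs0.le |>.trans (le_of_eq (by ring))) (by linarith only [hs0]) hs0 (by linarith only [hεa]) hcontr
    rw [sub_self, norm_zero, zero_div, zero_add] at h
    refine h.trans ?_
    rw [hcT, ← mul_div_assoc]
    refine div_le_div_of_nonneg_right ?_ hκC.le
    have h3 := mul_le_mul_of_nonneg_left hδCx hbH
    linarith only [h3]
  -- the field defect `D := c_T(j₀ + α)` of the pair `(T_UP, T_1(ιP))` (weights `≥ 1` since `k ≤ lev₀`)
  have hD : ∀ bd : Bond d (towerP L m (n + 1)),
      ‖JetSup.equiv (levWeight (L : ℝ) η lev₀ 1) (levWeight (L : ℝ) η lev₁ 2) (nabla115 η U) (T47 (H1LatticeCLM (L := (L : ℝ)) (η := η) (lev₀ := lev₀) (levB := levB) φ hposπ hQ lev₁ (nabla115 η U)) (Cck L m η (n + 1) U lev₀ lev₁ (nabla115 η U) levB) εC P) bd -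
        JetSup.equiv (levWeight (L : ℝ) η lev₀ 1) (levWeight (L : ℝ) η lev₁ 2) (nabla115 η (fun _ : Bond d (towerP L m (n + 1)) => (1 : 𝔸ˣ)))
          (T47 (H1LatticeCLM (L := (L : ℝ)) (η := η) (lev₀ := lev₀) (levB := levB) (c := ((η : ℂ))⁻¹)
        (R := adTransportW φ (fun _ : Bond d (towerP L m (n + 1)) => (1 : 𝔸ˣ)))
        (S := adTransportW φ fun _ : Bond d (towerP L m (n + 1)) => (1 : 𝔸ˣ)⁻¹) (Δ₁ := hessOp φ η (fun _ : Bond d (towerP L m (n + 1)) => (1 : 𝔸ˣ)) τ)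
        (Rr := RofUk L m n φ η (fun _ : Bond d (towerP L m (n + 1)) => (1 : 𝔸ˣ)))
        (Q := (QkW L m n φ (fun _ : Bond d (towerP L m (n + 1)) => (1 : 𝔸ˣ)) hL (fun _ => 0) (fun _ => by norm_num)
          (perCfg_UlevOf_one_mem_U1 L m (n + 1)) (norm_Wcx_UlevOf_one_sub_one_le L m (n + 1) (fun _ => 0) (fun _ => le_rfl)) (c₀ := c₀) (c₁ := c₁))) (a := a)
        φ hpos₁ hQ1 lev₁ (nabla115 η (fun _ : Bond d (towerP L m (n + 1)) => (1 : 𝔸ˣ))))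
            (Cck L m η (n + 1) (fun _ : Bond d (towerP L m (n + 1)) => (1 : 𝔸ˣ)) lev₀ lev₁ (nabla115 η (fun _ : Bond d (towerP L m (n + 1)) => (1 : 𝔸ˣ))) levB) εC ((LinearMap.toContinuousLinearMap
        ((jetLinearEquiv (L : ℝ) η lev₀ lev₁ (nabla115 η (fun _ : Bond d (towerP L m (n + 1)) => (1 : 𝔸ˣ)))).symm.toLinearMap ∘ₗ
          (jetLinearEquiv (L : ℝ) η lev₀ lev₁ (nabla115 η U)).toLinearMap)) P)) bd‖ ≤ cT * (j₀ + α) := by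
    intro bd
    have hw1 : 1 ≤ levWeight (L : ℝ) η lev₀ 1 bd := by
      rw [levWeight_apply, pow_one]
      calc (1 : ℝ) = (L : ℝ) ^ (n + 1) * η := hLη.symm
        _ ≤ (L : ℝ) ^ lev₀ bd * η := mul_le_mul_of_nonneg_right (pow_le_pow_right₀ hL1r (hlev bd)) hη0.le
    have hwm := JetSup.weight_mul_norm_apply_le ((LinearMap.toContinuousLinearMap
        ((jetLinearEquiv (L : ℝ) η lev₀ lev₁ (nabla115 η (fun _ : Bond d (towerP L m (n + 1)) => (1 : 𝔸ˣ)))).symm.toLinearMap ∘ₗ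
          (jetLinearEquiv (L : ℝ) η lev₀ lev₁ (nabla115 η U)).toLinearMap)) (T47 (H1LatticeCLM (L := (L : ℝ)) (η := η) (lev₀ := lev₀) (levB := levB) φ hposπ hQ lev₁ (nabla115 η U)) (Cck L m η (n + 1) U lev₀ lev₁ (nabla115 η U) levB) εC P) -
      T47 (H1LatticeCLM (L := (L : ℝ)) (η := η) (lev₀ := lev₀) (levB := levB) (c := ((η : ℂ))⁻¹)
        (R := adTransportW φ (fun _ : Bond d (towerP L m (n + 1)) => (1 : 𝔸ˣ)))
        (S := adTransportW φ fun _ : Bond d (towerP L m (n + 1)) => (1 : 𝔸ˣ)⁻¹) (Δ₁ := hessOp φ η (fun _ : Bond d (towerP L m (n + 1)) => (1 : 𝔸ˣ)) τ)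
        (Rr := RofUk L m n φ η (fun _ : Bond d (towerP L m (n + 1)) => (1 : 𝔸ˣ)))
        (Q := (QkW L m n φ (fun _ : Bond d (towerP L m (n + 1)) => (1 : 𝔸ˣ)) hL (fun _ => 0) (fun _ => by norm_num)
          (perCfg_UlevOf_one_mem_U1 L m (n + 1)) (norm_Wcx_UlevOf_one_sub_one_le L m (n + 1) (fun _ => 0) (fun _ => le_rfl)) (c₀ := c₀) (c₁ := c₁))) (a := a)
        φ hpos₁ hQ1 lev₁ (nabla115 η (fun _ : Bond d (towerP L m (n + 1)) => (1 : 𝔸ˣ))))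
        (Cck L m η (n + 1) (fun _ : Bond d (towerP L m (n + 1)) => (1 : 𝔸ˣ)) lev₀ lev₁ (nabla115 η (fun _ : Bond d (towerP L m (n + 1)) => (1 : 𝔸ˣ))) levB) εC ((LinearMap.toContinuousLinearMap
        ((jetLinearEquiv (L : ℝ) η lev₀ lev₁ (nabla115 η (fun _ : Bond d (towerP L m (n + 1)) => (1 : 𝔸ˣ)))).symm.toLinearMap ∘ₗ
          (jetLinearEquiv (L : ℝ) η lev₀ lev₁ (nabla115 η U)).toLinearMap)) P)) bd
    rw [JetSup.equiv_sub, Pi.sub_apply] at hwm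
    have e : JetSup.equiv (levWeight (L : ℝ) η lev₀ 1) (levWeight (L : ℝ) η lev₁ 2) (nabla115 η U) (T47 (H1LatticeCLM (L := (L : ℝ)) (η := η) (lev₀ := lev₀) (levB := levB) φ hposπ hQ lev₁ (nabla115 η U)) (Cck L m η (n + 1) U lev₀ lev₁ (nabla115 η U) levB) εC P) =
        JetSup.equiv (levWeight (L : ℝ) η lev₀ 1) (levWeight (L : ℝ) η lev₁ 2) (nabla115 η (fun _ : Bond d (towerP L m (n + 1)) => (1 : 𝔸ˣ))) ((LinearMap.toContinuousLinearMap
        ((jetLinearEquiv (L : ℝ) η lev₀ lev₁ (nabla115 η (fun _ : Bond d (towerP L m (n + 1)) => (1 : 𝔸ˣ)))).symm.toLinearMap ∘ₗ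
          (jetLinearEquiv (L : ℝ) η lev₀ lev₁ (nabla115 η U)).toLinearMap)) (T47 (H1LatticeCLM (L := (L : ℝ)) (η := η) (lev₀ := lev₀) (levB := levB) φ hposπ hQ lev₁ (nabla115 η U)) (Cck L m η (n + 1) U lev₀ lev₁ (nabla115 η U) levB) εC P)) := rfl
    rw [e]
    calc _ ≤ levWeight (L : ℝ) η lev₀ 1 bd * _ := le_mul_of_one_le_left (norm_nonneg _) hw1
      _ ≤ _ := hwm
      _ ≤ (j₀ + α) * cT := hT
      _ = cT * (j₀ + α) := mul_comm _ _
  -- (4) the two-background kernel-column letters at `D := c_T(j₀ + α)`, weakened to `ϖΞ̂(j₀ + α)`, `ϖ′Ξ̂(j₀ + α)‖X‖`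
  obtain ⟨hΘEδ, hΘ'δ⟩ := HA n η hηL c₀ c₁ hw hρ' m hm U αU hα0 hα1 hαL hU1 hreg εU hεU hε1 hUε hLb α hα hαA' hUst hUb hUη hUw hpl hUgrad hRlev hεg hAQ hpos' hpos
    hc₀η j₀ hJ hjA' hposπ hQ hpos'₁ hpos₁ hQ1 lev₀ levB lev₁ hlev hUG h52 h7E h7dX (by linarith only [hαr']) RC RC₁ haC (by linarith only [hεa, hs0]) hϖ0 hϖ hϖ'0 hϖ' hqA P hPa hιPa
    (by positivity : 0 ≤ cT * (j₀ + α)) hD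
  have hΞ : 2 * (εC + aC) * ((j₀ + α) * (Mφ * KA * Mφ' * (d * latticeConst d κA)) * (C3Gen d L * (2 ^ d * (2 * d)))) +
      (2 * ((Mφ * BA * Mφ' * (d * latticeConst d δA)) * ((6 * α / r' + 24 * (cT * (j₀ + α)) / ρ) * (C3Cplx d L * ρ) * (2 ^ d * (2 * d)))) +
        4 * (εC + aC) * ((Mφ * BA * Mφ' * (d * latticeConst d δA)) * (C3Gen d L * (2 ^ d * (2 * d)))) *
          ((εC + aC) * ((j₀ + α) * (Mφ * KA * Mφ' * (d * latticeConst d κA)) * (C3Gen d L * (2 ^ d * (2 * d)))) +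
            (Mφ * BA * Mφ' * (d * latticeConst d δA)) * ((6 * α / r' + 24 * (cT * (j₀ + α)) / ρ) * (C3Cplx d L * ρ) * (2 ^ d * (2 * d))))) ≤ Ξh * (j₀ + α) := by
    have hΓ : (6 * α / r' + 24 * (cT * (j₀ + α)) / ρ) * (C3Cplx d L * ρ) * (2 ^ d * (2 * d)) ≤ (j₀ + α) * Γh := by
      rw [hΓh, show (j₀ + α) * ((6 / r' + 24 * cT / ρ) * (C3Cplx d L * ρ) * (2 ^ d * (2 * d))) =
        (6 * (j₀ + α) / r' + 24 * (cT * (j₀ + α)) / ρ) * (C3Cplx d L * ρ) * (2 ^ d * (2 * d)) by ring]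
      gcongr
    have hΘA0 : 0 ≤ Mφ * BA * Mφ' * (d * latticeConst d δA) := by positivity
    have hP1 : 0 ≤ (Mφ * BA * Mφ' * (d * latticeConst d δA)) * (C3Gen d L * (2 ^ d * (2 * d))) := by positivity
    have h1 := mul_le_mul_of_nonneg_left hΓ hΘA0
    have h2 := mul_le_mul_of_nonneg_left h1 (by positivity : 0 ≤ 4 * (εC + aC) * ((Mφ * BA * Mφ' * (d * latticeConst d δA)) * (C3Gen d L * (2 ^ d * (2 * d)))))
    rw [hΞh]; linarith only [h1, h2]
  have hδΘE : ∀ bb : Bond d (towerP L m (n + 1)), _ ≤ ϖ * Ξh * (j₀ + α) := fun bb =>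
    (hΘEδ bb).trans ((mul_le_mul_of_nonneg_left hΞ hϖ0).trans (le_of_eq (by ring)))
  have hδΘ' : ∀ (bb : Bond d (towerP L m (n + 1))) (X : 𝔸), _ ≤ ϖ' * Ξh * (j₀ + α) * ‖X‖ := fun bb X =>
    (hΘ'δ bb X).trans ((mul_le_mul_of_nonneg_right (mul_le_mul_of_nonneg_left hΞ hϖ'0) (norm_nonneg X)).trans (le_of_eq (by ring)))
  -- (5) the one-background letters at `U` and at the vacuum; `δ_N`
  obtain ⟨-, hΘ3U, hNU⟩ := HBU n η hηL c₀ c₁ hw hρ' m hm U αU hα0 hα1 hαL hU1 hreg εU hεU hUε hLb α hα hαB' hUst hUb hUη hpl hUgrad hRlev hεg hAQ hpos' hpos hc₀η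
    j₀ hJ hjB' hposπ hQ lev₀ lev₁ (nabla115 η U) levB hUG h52 hlev RC haC (by linarith only [hεa, hs0]) hϖ0 hϖ hqE
  obtain ⟨hΘEV, hΘ3V, hNV⟩ := HBV hAQ0 n η hηL c₀ c₁ hw hρ' m hm hpos'₁ hpos₁ hc₀η hQ1 lev₀ lev₁ (nabla115 η (fun _ : Bond d (towerP L m (n + 1)) => (1 : 𝔸ˣ))) levB hlev RC₁ haC (by linarith only [hεa, hs0]) hϖ0 hϖ hqE
  have hNle : (NegSup.wSup (levWeight (L : ℝ) η lev₀ 3) : ℝ) * (Mφ * BN * Mφ' * (d * latticeConst d δN)) * (NegSup.wInvSup (levWeight (L : ℝ) η levB 0) : ℝ) ≤ Nh := by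
    rw [hNh]; have h0 : 0 ≤ Mφ * BN * Mφ' * (d * latticeConst d δN) := by positivity
    exact mul_le_mul (mul_le_mul_of_nonneg_right hw₃ h0) hwB hwBn (mul_nonneg hω₃0 h0)
  have hN₁ := fun X : NegSize (L : ℝ) η levB 0 𝔸 => (hNU X).trans (mul_le_mul_of_nonneg_right hNle (norm_nonneg X))
  have hN₂ := fun X : NegSize (L : ℝ) η levB 0 𝔸 => (hNV X).trans (mul_le_mul_of_nonneg_right hNle (norm_nonneg X))
  have hδN := fun X : NegSize (L : ℝ) η levB 0 𝔸 =>
    (H5 n η hηL c₀ c₁ hw hρ' m hm U αU hα0 hα1 hαL hU1 hreg εU hεU hε1 hUε hLb α hα hα5' hUst hUb hUη hUw hpl hUgrad hRlev hεg hAQ hpos' hpos hc₀η j₀ hJ hj5'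
      hposπ hQ hpos'₁ hpos₁ hQ1 lev₀ lev₁ (nabla115 η U) (nabla115 η (fun _ : Bond d (towerP L m (n + 1)) => (1 : 𝔸ˣ))) levB X).trans
      (show _ ≤ cN * (j₀ + α) * ‖X‖ from mul_le_mul_of_nonneg_right (by
        rw [hcN]; have h0 : 0 ≤ (j₀ + α) * (Mφ * K5 * Mφ') * (d * latticeConst d κ5) := by positivity
        calc _ ≤ ω₃ * ((j₀ + α) * (Mφ * K5 * Mφ') * (d * latticeConst d κ5)) * ΩB := mul_le_mul (mul_le_mul_of_nonneg_right hw₃ h0) hwB hwBn (mul_nonneg hω₃0 h0)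
          _ = _ := by ring) (norm_nonneg X))
  -- (6) `δ_{CT}`: `δ_C` at `T_UP` plus the Lipschitz bound of `C_k(1)` on the half ball (Cauchy)
  have hTU : ‖T47 (H1LatticeCLM (L := (L : ℝ)) (η := η) (lev₀ := lev₀) (levB := levB) φ hposπ hQ lev₁ (nabla115 η U)) (Cck L m η (n + 1) U lev₀ lev₁ (nabla115 η U) levB) εC P‖ < εC + aC := norm_T47_lt RC hPa
  have hT1 : ‖T47 (H1LatticeCLM (L := (L : ℝ)) (η := η) (lev₀ := lev₀) (levB := levB) (c := ((η : ℂ))⁻¹)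
        (R := adTransportW φ (fun _ : Bond d (towerP L m (n + 1)) => (1 : 𝔸ˣ)))
        (S := adTransportW φ fun _ : Bond d (towerP L m (n + 1)) => (1 : 𝔸ˣ)⁻¹) (Δ₁ := hessOp φ η (fun _ : Bond d (towerP L m (n + 1)) => (1 : 𝔸ˣ)) τ)
        (Rr := RofUk L m n φ η (fun _ : Bond d (towerP L m (n + 1)) => (1 : 𝔸ˣ)))
        (Q := (QkW L m n φ (fun _ : Bond d (towerP L m (n + 1)) => (1 : 𝔸ˣ)) hL (fun _ => 0) (fun _ => by norm_num)
          (perCfg_UlevOf_one_mem_U1 L m (n + 1)) (norm_Wcx_UlevOf_one_sub_one_le L m (n + 1) (fun _ => 0) (fun _ => le_rfl)) (c₀ := c₀) (c₁ := c₁))) (a := a)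
        φ hpos₁ hQ1 lev₁ (nabla115 η (fun _ : Bond d (towerP L m (n + 1)) => (1 : 𝔸ˣ))))
      (Cck L m η (n + 1) (fun _ : Bond d (towerP L m (n + 1)) => (1 : 𝔸ˣ)) lev₀ lev₁ (nabla115 η (fun _ : Bond d (towerP L m (n + 1)) => (1 : 𝔸ˣ))) levB) εC ((LinearMap.toContinuousLinearMap
        ((jetLinearEquiv (L : ℝ) η lev₀ lev₁ (nabla115 η (fun _ : Bond d (towerP L m (n + 1)) => (1 : 𝔸ˣ)))).symm.toLinearMap ∘ₗ
          (jetLinearEquiv (L : ℝ) η lev₀ lev₁ (nabla115 η U)).toLinearMap)) P)‖ < εC + aC := norm_T47_lt RC₁ hιPa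
  have hιTU : ‖(LinearMap.toContinuousLinearMap
        ((jetLinearEquiv (L : ℝ) η lev₀ lev₁ (nabla115 η (fun _ : Bond d (towerP L m (n + 1)) => (1 : 𝔸ˣ)))).symm.toLinearMap ∘ₗ
          (jetLinearEquiv (L : ℝ) η lev₀ lev₁ (nabla115 η U)).toLinearMap)) (T47 (H1LatticeCLM (L := (L : ℝ)) (η := η) (lev₀ := lev₀) (levB := levB) φ hposπ hQ lev₁ (nabla115 η U)) (Cck L m η (n + 1) U lev₀ lev₁ (nabla115 η U) levB) εC P)‖ ≤ 2 * (εC + aC) := (hι2 _).trans (by linarith only [hTU])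
  have hCT : ‖(Cck L m η (n + 1) U lev₀ lev₁ (nabla115 η U) levB) (T47 (H1LatticeCLM (L := (L : ℝ)) (η := η) (lev₀ := lev₀) (levB := levB) φ hposπ hQ lev₁ (nabla115 η U)) (Cck L m η (n + 1) U lev₀ lev₁ (nabla115 η U) levB) εC P) -
      (Cck L m η (n + 1) (fun _ : Bond d (towerP L m (n + 1)) => (1 : 𝔸ˣ)) lev₀ lev₁ (nabla115 η (fun _ : Bond d (towerP L m (n + 1)) => (1 : 𝔸ˣ))) levB) (T47 (H1LatticeCLM (L := (L : ℝ)) (η := η) (lev₀ := lev₀) (levB := levB) (c := ((η : ℂ))⁻¹)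
        (R := adTransportW φ (fun _ : Bond d (towerP L m (n + 1)) => (1 : 𝔸ˣ)))
        (S := adTransportW φ fun _ : Bond d (towerP L m (n + 1)) => (1 : 𝔸ˣ)⁻¹) (Δ₁ := hessOp φ η (fun _ : Bond d (towerP L m (n + 1)) => (1 : 𝔸ˣ)) τ)
        (Rr := RofUk L m n φ η (fun _ : Bond d (towerP L m (n + 1)) => (1 : 𝔸ˣ)))
        (Q := (QkW L m n φ (fun _ : Bond d (towerP L m (n + 1)) => (1 : 𝔸ˣ)) hL (fun _ => 0) (fun _ => by norm_num)
          (perCfg_UlevOf_one_mem_U1 L m (n + 1)) (norm_Wcx_UlevOf_one_sub_one_le L m (n + 1) (fun _ => 0) (fun _ => le_rfl)) (c₀ := c₀) (c₁ := c₁))) (a := a)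
        φ hpos₁ hQ1 lev₁ (nabla115 η (fun _ : Bond d (towerP L m (n + 1)) => (1 : 𝔸ˣ))))
        (Cck L m η (n + 1) (fun _ : Bond d (towerP L m (n + 1)) => (1 : 𝔸ˣ)) lev₀ lev₁ (nabla115 η (fun _ : Bond d (towerP L m (n + 1)) => (1 : 𝔸ˣ))) levB) εC ((LinearMap.toContinuousLinearMap
        ((jetLinearEquiv (L : ℝ) η lev₀ lev₁ (nabla115 η (fun _ : Bond d (towerP L m (n + 1)) => (1 : 𝔸ˣ)))).symm.toLinearMap ∘ₗ
          (jetLinearEquiv (L : ℝ) η lev₀ lev₁ (nabla115 η U)).toLinearMap)) P))‖ ≤ cCT * (j₀ + α) := by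
    have h1 := hδC _ hTU
    have h2 := norm_sub_le_of_quad hρ0 hC2T hC₁.quad hC₁.differentiableOn (ρ := 2 * (εC + aC)) (by linarith only [hεa, hs0]) hιTU (hT1.le.trans (by linarith only [hs0]))
    refine (norm_sub_le_norm_sub_add_norm_sub _ ((Cck L m η (n + 1) (fun _ : Bond d (towerP L m (n + 1)) => (1 : 𝔸ˣ)) lev₀ lev₁ (nabla115 η (fun _ : Bond d (towerP L m (n + 1)) => (1 : 𝔸ˣ))) levB) ((LinearMap.toContinuousLinearMap
        ((jetLinearEquiv (L : ℝ) η lev₀ lev₁ (nabla115 η (fun _ : Bond d (towerP L m (n + 1)) => (1 : 𝔸ˣ)))).symm.toLinearMap ∘ₗ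
          (jetLinearEquiv (L : ℝ) η lev₀ lev₁ (nabla115 η U)).toLinearMap)) (T47 (H1LatticeCLM (L := (L : ℝ)) (η := η) (lev₀ := lev₀) (levB := levB) φ hposπ hQ lev₁ (nabla115 η U)) (Cck L m η (n + 1) U lev₀ lev₁ (nabla115 η U) levB) εC P))) _).trans ?_
    rw [hcCT]
    have h3 := mul_le_mul_of_nonneg_left hT (by positivity : 0 ≤ 4 * C2T d α₀ * (2 * (εC + aC)))
    linarith only [h1, h2, hδCx, h3]
  -- (7) the V₀-group: `n_V`, and `δ_{VT}` from the lattice-free modulus at `T_UP` plus the Lipschitz bound of the entire `curV0(1)` on the half ball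
  have hTV : ‖T47 (H1LatticeCLM (L := (L : ℝ)) (η := η) (lev₀ := lev₀) (levB := levB) φ hposπ hQ lev₁ (nabla115 η U)) (Cck L m η (n + 1) U lev₀ lev₁ (nabla115 η U) levB) εC P‖ < RV := by linarith only [hTU, hεV, hs0]
  have hnV := (hqV _ hTV).trans (mul_le_mul_of_nonneg_left (pow_le_pow_left₀ (norm_nonneg _) hTU.le 2) hCV)
  have hV1 : Differentiable ℂ (curV0 (L := (L : ℝ)) (η := η) (lev₀ := lev₀) (lev₁ := lev₁) (Dc := nabla115 η (fun _ : Bond d (towerP L m (n + 1)) => (1 : 𝔸ˣ))) ρV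
      (LinearMap.toContinuousLinearMap τ) (fun _ : Bond d (towerP L m (n + 1)) => (1 : 𝔸ˣ))) :=
    (differentiable_curV0prime (lev₁ := lev₁) (Dc := nabla115 η (fun _ : Bond d (towerP L m (n + 1)) => (1 : 𝔸ˣ))) ρV (LinearMap.toContinuousLinearMap τ) (fun _ : Bond d (towerP L m (n + 1)) => (1 : 𝔸ˣ))).add
      (differentiable_curComm (lev₁ := lev₁) (Dc := nabla115 η (fun _ : Bond d (towerP L m (n + 1)) => (1 : 𝔸ˣ))) ρV (LinearMap.toContinuousLinearMap τ) (fun _ : Bond d (towerP L m (n + 1)) => (1 : 𝔸ˣ)))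
  have hVT : ‖curV0 (lev₁ := lev₁) (Dc := nabla115 η U) ρV (LinearMap.toContinuousLinearMap τ) U (T47 (H1LatticeCLM (L := (L : ℝ)) (η := η) (lev₀ := lev₀) (levB := levB) φ hposπ hQ lev₁ (nabla115 η U)) (Cck L m η (n + 1) U lev₀ lev₁ (nabla115 η U) levB) εC P) -
      curV0 (lev₁ := lev₁) (Dc := nabla115 η (fun _ : Bond d (towerP L m (n + 1)) => (1 : 𝔸ˣ))) ρV (LinearMap.toContinuousLinearMap τ) (fun _ : Bond d (towerP L m (n + 1)) => (1 : 𝔸ˣ))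
        (T47 (H1LatticeCLM (L := (L : ℝ)) (η := η) (lev₀ := lev₀) (levB := levB) (c := ((η : ℂ))⁻¹)
        (R := adTransportW φ (fun _ : Bond d (towerP L m (n + 1)) => (1 : 𝔸ˣ)))
        (S := adTransportW φ fun _ : Bond d (towerP L m (n + 1)) => (1 : 𝔸ˣ)⁻¹) (Δ₁ := hessOp φ η (fun _ : Bond d (towerP L m (n + 1)) => (1 : 𝔸ˣ)) τ)
        (Rr := RofUk L m n φ η (fun _ : Bond d (towerP L m (n + 1)) => (1 : 𝔸ˣ)))
        (Q := (QkW L m n φ (fun _ : Bond d (towerP L m (n + 1)) => (1 : 𝔸ˣ)) hL (fun _ => 0) (fun _ => by norm_num)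
          (perCfg_UlevOf_one_mem_U1 L m (n + 1)) (norm_Wcx_UlevOf_one_sub_one_le L m (n + 1) (fun _ => 0) (fun _ => le_rfl)) (c₀ := c₀) (c₁ := c₁))) (a := a)
        φ hpos₁ hQ1 lev₁ (nabla115 η (fun _ : Bond d (towerP L m (n + 1)) => (1 : 𝔸ˣ))))
          (Cck L m η (n + 1) (fun _ : Bond d (towerP L m (n + 1)) => (1 : 𝔸ˣ)) lev₀ lev₁ (nabla115 η (fun _ : Bond d (towerP L m (n + 1)) => (1 : 𝔸ˣ))) levB) εC ((LinearMap.toContinuousLinearMap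
        ((jetLinearEquiv (L : ℝ) η lev₀ lev₁ (nabla115 η (fun _ : Bond d (towerP L m (n + 1)) => (1 : 𝔸ˣ)))).symm.toLinearMap ∘ₗ
          (jetLinearEquiv (L : ℝ) η lev₀ lev₁ (nabla115 η U)).toLinearMap)) P))‖ ≤ cVT * (j₀ + α) := by
    have h1 := curV0_background_modulus_flat_latticeUniform (L := (L : ℝ)) (η := η) (lev₀ := lev₀) (lev₁ := lev₁) hd (Dc₁ := nabla115 η U)
      (Dc₂ := nabla115 η (fun _ : Bond d (towerP L m (n + 1)) => (1 : 𝔸ˣ))) lev₁ ρV (LinearMap.toContinuousLinearMap τ) U hUb hα hUη hL1r hω1 hΩ1 hw₀ hw₁' hw₁₂ hRV hRV' _ hTV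
    have h2 := norm_sub_le_of_quad_entire hV1 hCV hRV hqV₁ (lt_of_le_of_lt hιTU (by linarith only [hεV])) (hT1.trans (by linarith only [hεV, hs0]))
    refine (norm_sub_le_norm_sub_add_norm_sub _ (curV0 (lev₁ := lev₁) (Dc := nabla115 η (fun _ : Bond d (towerP L m (n + 1)) => (1 : 𝔸ˣ))) ρV (LinearMap.toContinuousLinearMap τ) (fun _ : Bond d (towerP L m (n + 1)) => (1 : 𝔸ˣ))
      ((LinearMap.toContinuousLinearMap
        ((jetLinearEquiv (L : ℝ) η lev₀ lev₁ (nabla115 η (fun _ : Bond d (towerP L m (n + 1)) => (1 : 𝔸ˣ)))).symm.toLinearMap ∘ₗ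
          (jetLinearEquiv (L : ℝ) η lev₀ lev₁ (nabla115 η U)).toLinearMap)) (T47 (H1LatticeCLM (L := (L : ℝ)) (η := η) (lev₀ := lev₀) (levB := levB) φ hposπ hQ lev₁ (nabla115 η U)) (Cck L m η (n + 1) U lev₀ lev₁ (nabla115 η U) levB) εC P))) _).trans ?_
    have hKVle : 524288 * Real.exp 4 * ((d - 1 : ℕ) : ℝ) * (ω * Ω) ^ 2 * ‖ρV‖ * ‖LinearMap.toContinuousLinearMap τ‖ * RV ^ 2 * ω ≤ KV := by
      rw [hKV]; gcongr
    rw [hcVT]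
    have h3 := mul_le_mul hKVle hαx hα hKV0
    have h4 := mul_le_mul_of_nonneg_left hT (by positivity : 0 ≤ 2 * CV * RV)
    linarith only [h1, h2, h3, h4]
  -- (8) the (27)-symmetry at `U` and at the vacuum
  have hsym₁ := pairSum_current_laplaceAkPi_sub_QaQ_comm L m n φ τ η hUlev hUst hφτ hτ₁ hτ₂ a' hpos' hL αU hα1 hU1 hreg (Lr := (L : ℝ)) (lev₀ := lev₀)
    lev₁ (nabla115 η U) a
  have hsym₂ := pairSum_current_flat_chain_comm L hL φ τ hτ₁ hτ₂ hφτ m n η hpos'₁ lev₀ lev₁ (nabla115 η (fun _ : Bond d (towerP L m (n + 1)) => (1 : 𝔸ˣ))) (a := a)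
  -- (9) THE JUNCTION at the pair `(P, ιP)`
  have hW := norm_W80_sub_W80_le_pair ρV (LinearMap.toContinuousLinearMap τ) RC hC RC₁ hC₁ U (fun _ : Bond d (towerP L m (n + 1)) => (1 : 𝔸ˣ)) J₁ J₂ _ _ hsym₁ hsym₂ (flat115_jetId P) hPa hιPa
    hθ₃0 hθE0 hNh0 (by positivity : 0 ≤ cN * (j₀ + α)) (by positivity : 0 ≤ ϖ' * Ξh * (j₀ + α)) (by positivity : 0 ≤ ϖ * Ξh * (j₀ + α))
    (fun bb => (hΘ3U P hPa bb).trans (le_of_eq (by rw [hθ₃]))) (fun bb => (hΘ3V _ hιPa bb).trans (le_of_eq (by rw [hθ₃])))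
    (fun bb => (hΘEV _ hιPa bb).trans (le_of_eq (by rw [hθE]))) hN₁ hN₂ hδN hCT hδΘ' hδΘE hnV hVT
  refine hW.trans ?_
  -- (10) every remaining norm below its displayed bound; the result is LINEAR in `j₀ + α`
  have hJ₁' : ‖J₁‖ ≤ MJ * (j₀ + α) := hJ₁.trans (mul_le_mul_of_nonneg_left hαx' hMJ)
  have hJ₂' : ‖J₂‖ ≤ MJ * (j₀ + α) := hJ₂.trans (mul_le_mul_of_nonneg_left hαx' hMJ)
  have hPa' := hPa.le
  have hιPa' := hιPa.le
  have hTU' := hTU.le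
  have hfin : ‖ρV‖ * ‖LinearMap.toContinuousLinearMap τ‖ * θ₃ * (‖J₁‖ * ‖P‖ ^ 2 + ‖J₂‖ * ‖(LinearMap.toContinuousLinearMap
        ((jetLinearEquiv (L : ℝ) η lev₀ lev₁ (nabla115 η (fun _ : Bond d (towerP L m (n + 1)) => (1 : 𝔸ˣ)))).symm.toLinearMap ∘ₗ
          (jetLinearEquiv (L : ℝ) η lev₀ lev₁ (nabla115 η U)).toLinearMap)) P‖ ^ 2) +
      ((cN * (j₀ + α) * (C2T d α₀ * (1 / (1 - 4 * bH * C2T d α₀ * (εC + aC))) ^ 2 * ‖P‖ ^ 2) + Nh * (cCT * (j₀ + α))) +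
        ‖ρV‖ * ‖LinearMap.toContinuousLinearMap τ‖ * (ϖ' * Ξh * (j₀ + α)) * ‖P‖) +
      ‖ρV‖ * ‖LinearMap.toContinuousLinearMap τ‖ * (ϖ * Ξh * (j₀ + α) * (Nh * C2T d α₀ * (1 / (1 - 4 * bH * C2T d α₀ * (εC + aC))) ^ 2 * ‖P‖ ^ 2) +
        θE * ‖(LinearMap.toContinuousLinearMap
        ((jetLinearEquiv (L : ℝ) η lev₀ lev₁ (nabla115 η (fun _ : Bond d (towerP L m (n + 1)) => (1 : 𝔸ˣ)))).symm.toLinearMap ∘ₗ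
          (jetLinearEquiv (L : ℝ) η lev₀ lev₁ (nabla115 η U)).toLinearMap)) P‖ * (cN * (j₀ + α) * (C2T d α₀ * (1 / (1 - 4 * bH * C2T d α₀ * (εC + aC))) ^ 2 * ‖P‖ ^ 2) + Nh * (cCT * (j₀ + α)))) +
      ‖ρV‖ * ‖LinearMap.toContinuousLinearMap τ‖ * (ϖ * Ξh * (j₀ + α) * (CV * (εC + aC) ^ 2) + (1 + θE * ‖(LinearMap.toContinuousLinearMap
        ((jetLinearEquiv (L : ℝ) η lev₀ lev₁ (nabla115 η (fun _ : Bond d (towerP L m (n + 1)) => (1 : 𝔸ˣ)))).symm.toLinearMap ∘ₗ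
          (jetLinearEquiv (L : ℝ) η lev₀ lev₁ (nabla115 η U)).toLinearMap)) P‖) * (cVT * (j₀ + α))) ≤
      Mρ * Cτ * θ₃ * (MJ * (j₀ + α) * aC ^ 2 + MJ * (j₀ + α) * aC ^ 2) +
      ((cN * (j₀ + α) * (C2T d α₀ * (1 / (1 - 4 * bH * C2T d α₀ * (εC + aC))) ^ 2 * aC ^ 2) + Nh * (cCT * (j₀ + α))) + Mρ * Cτ * (ϖ' * Ξh * (j₀ + α)) * aC) +
      Mρ * Cτ * (ϖ * Ξh * (j₀ + α) * (Nh * C2T d α₀ * (1 / (1 - 4 * bH * C2T d α₀ * (εC + aC))) ^ 2 * aC ^ 2) +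
        θE * aC * (cN * (j₀ + α) * (C2T d α₀ * (1 / (1 - 4 * bH * C2T d α₀ * (εC + aC))) ^ 2 * aC ^ 2) + Nh * (cCT * (j₀ + α)))) +
      Mρ * Cτ * (ϖ * Ξh * (j₀ + α) * (CV * (εC + aC) ^ 2) + (1 + θE * aC) * (cVT * (j₀ + α))) := by
    gcongr
  refine hfin.trans (le_of_eq ?_)
  rw [hK]; ring

end Literature.MathematicalPhysics.QuantumFieldTheory.Balaban1983to89.B11Ineq98W80TwoBackgroundLatticeFree

end
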